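/-
Origin: expansion seat `planner-pub-hodgecm-carver-g2-0`, handover 2026-08-18T04:13:36Z (`HOME/pub-hodgecm-carver-g2/lean/CarverG2/PerL34/SeamVacuity.lean`, md5 7e63a955, 93 lines);
landed by the gen-5 packager in gate run 21 as `HodgeCM/PerL34/SeamVacuity.lean` (verbatim).
-/
/-
pub-hodgecm cell — THE CARVER gen 2 (session planner-pub-hodgecm-carver-g2-0, unit pub-hodgecm-carver-g2).
`SeamVacuity`: a BOUNDARY WITNESS for seam S3 of LEMMAS.md v4 §9 / GAPS carverg2-X1 — no mathematics of PerL,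
nothing posited, nothing cited.  It records, as a kernel theorem, that the N31 cluster interface
`HodgeCM.PerL34.ClusterOutputs T` (pv13, `CharsAssembly.lean`) is LOGICALLY NO STRONGER than the open input it
feeds, `T.Open_chars`, as soon as each `L²([G_U])` space `T.HG L ι₁ V` has a nonzero vector: given `Open_chars`, a
`SideOutputs` record is built from a `LocalFactorDatum` with JUNK numerics (one place, no exceptional set, all local
factors `1`, `c = vol = 1`, theta := any unit vector) and `allowed_of_pair := Open_chars`.  Hence
`ClusterOutputs T ↔ T.Open_chars` (the forward direction is pv13's `open_chars_of_cluster`).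
MEANING (for referees, not an objection): the by-name closure `N31_of_cluster : ClusterOutputs T → N31_chars T` carries
the content of the N31 files (doubling, Siegel–Weil, Rallis, local factors, unramified places, Euler product) to the
model ONLY through an HONEST instantiation that pins `LocalFactorDatum.theta` to the model's theta lift and the
numeric fields to the actual local integrals — i.e. through the missing D4 bridge `SideOutputs.ofN31Files` (seam S3).
The typed cone cannot tell an honest instance from this junk one; that distinction lives at the instantiation
boundary, which is exactly where LEMMAS §9 locates what is not 'closed modulo published citations only'.
-/
import Summits.HodgeConjecture.HodgeCM.PerL34.CharsAssembly

/-! PORT of `HodgeCM/PerL34/SeamVacuity.lean` (HodgeCMPerL run 82) — verbatim mechanical port; provenance in the PORT header line. -/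

set_option autoImplicit false

noncomputable section

namespace HodgeCM
namespace PerL34

open HodgeCM.Prior.Perl34File EulerProduct
open scoped InnerProductSpace

section Junk

variable {E : Type*} [NormedAddCommGroup E] [InnerProductSpace ℂ E]

/-- A `LocalFactorDatum` over ONE place with junk numerics around a unit vector `θ`: `I ≡ 1`, `S = ∅`, `q ≡ 2`,
`χ'(ϖ) = ν(ϖ) = 1`, no split place, `c = vol = 1`, `Theta = {θ}`; the Rallis field reads `re ⟪θ,θ⟫ = 1·1·∏' 1`. -/
def LocalFactorDatum.junk (θ : E) (hθ : ‖θ‖ = 1) : LocalFactorDatum PUnit E where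
  I := fun _ => 1
  S := ∅
  q := fun _ => 2
  chiPi := fun _ => 1
  nuPi := fun _ => 1
  IsSplit := fun _ => False
  c := 1
  vol := 1
  c_pos := one_pos
  vol_pos := one_pos
  theta := θ
  Theta := {θ}
  theta_mem := Set.mem_singleton θ
  two_le_q := fun _ _ => le_rfl
  chi_norm := fun _ _ => by simp
  nu_norm := fun _ _ => by simp
  ram_pos := fun v hv => by simp at hv
  split_val := fun _ _ h => h.elim
  nonsplit_val := fun _ _ _ => rfl
  summable_t := .of_finite
  rallis := by
    have h : ⟪θ, θ⟫_ℂ = ((‖θ‖ : ℂ)) ^ 2 := inner_self_eq_norm_sq_to_K θ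
    rw [h, hθ, tprod_one]
    simp

end Junk

variable {U : Universe} (T : U.ThetaModel)

/-- **Boundary witness (seam S3).** If every `L²([G_U])` space of the model has a nonzero vector, then the N31
cluster interface FOLLOWS from the open input `Open_chars` it is meant to feed: the junk `LocalFactorDatum` on
both lines plus `allowed_of_pair := Open_chars`. -/
theorem clusterOutputs_of_open_chars
    (hNT : ∀ {L : CMField} {ι₁ : L →+* ℂ} (V : HermSpace3 L ι₁), ∃ x : T.HG L ι₁ V, x ≠ 0)
    (hch : T.Open_chars) : ClusterOutputs T := by
  intro L ι₁ V c hc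
  obtain ⟨x, hx⟩ := hNT V
  have hθ : ‖(‖x‖⁻¹ : ℂ) • x‖ = 1 := norm_smul_inv_norm hx
  exact ⟨PUnit,
    ⟨{ fst := fun _ => LocalFactorDatum.junk _ hθ
       snd := fun _ => LocalFactorDatum.junk _ hθ
       allowed_of_pair := fun χ _ _ => (hch V c hc).1 χ }⟩,
    ⟨{ fst := fun _ => LocalFactorDatum.junk _ hθ
       snd := fun _ => LocalFactorDatum.junk _ hθ
       allowed_of_pair := fun χ _ _ => (hch V c hc).2 χ }⟩⟩

/-- **Seam S3 as an equivalence**: modulo a nonzero `L²` vector per surface datum, `ClusterOutputs T ↔ T.Open_chars`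
(→ is pv13's `open_chars_of_cluster`).  So the interface adds no logical strength to the open input; its value is
as the TARGET TYPE of an honest instantiation from the N31 files. -/
theorem clusterOutputs_iff_open_chars
    (hNT : ∀ {L : CMField} {ι₁ : L →+* ℂ} (V : HermSpace3 L ι₁), ∃ x : T.HG L ι₁ V, x ≠ 0) :
    ClusterOutputs T ↔ T.Open_chars :=
  ⟨open_chars_of_cluster T, clusterOutputs_of_open_chars T hNT⟩

end PerL34
end HodgeCM

end
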